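import Literature.MathematicalPhysics.QuantumFieldTheory.Balaban1983to89.B9SmoothHolderClassTClosure
import Literature.MathematicalPhysics.QuantumFieldTheory.Balaban1983to89.B9Eq340HolderLipParSymY
import Literature.MathematicalPhysics.QuantumFieldTheory.Balaban1983to89.B6BlockDecayHprimeCovV1

/-!
# `Balaban1983to89.B9SmoothHolderClassTGradientTools` — the tools for reading print's mean-value step «|Ψ(z) − R(U(Γ_{z,z′}))Ψ(z′)| ≦ |Γ_{z,z′}|·sup_Γ|∇_UΨ|»
# in dag-n06-d's coordinates along def-Y's taxicab contour: the chart dictionary (lattice `ℓ^∞` distance = torus distance), the transported pair difference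
# of the class `bHZT` bounded by the gradient model `DvcoKH` at the rungs, and the geometry of the rung bonds seen from the enlarged block `Δ̃(y)`

T. Bałaban, *Propagators for lattice gauge theories in a background field*, Commun. Math. Phys. **99** (1985) 389–434
[`Balaban1985BackgroundPropagators`, "B9"]; [4] = T. Bałaban, *Propagators and renormalization transformations for lattice gauge
theories. II*, Commun. Math. Phys. **96** (1984) 223–250 [`Balaban1984PropagatorsII`].

statement-level skeleton of published theorems with citation tags; proofs where landed; nothing here is a claim about the
Yang–Mills mass gap

THE PRINTED LOCI (held text `paper:balaban1985-cmp99-background-propagators`, pp. 397–398 re-read).  (3.40) p. 397: *"‖A‖_α = max sup_{x,x′:|x−x′|≦1}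
|x − x′|^{−α}|R(U(Γ_{x,x′}))A(x′) − A(x)| … where Γ_{x,x′} is a shortest contour connecting points x and x′.  It is understood that the η-scale is used"*; (3.3)
pp. 390–391 (`D_U = η⁻¹∇_U`); p. 423 (Thm 3.12: the zeroth-order Hölder member read off the sup bounds along `Γ_{x,x′}`); [4] (2.1)–(2.2) p. 224 (the chart, the
two-level window), (2.45)–(2.46) p. 231 (the block distance).

WHY THIS FILE (cell `pub-ymgap`, node N06, seat dag-n06-l g24; part 1 of the «producers INTO `bH13`» programme, `PRODUCERS-INTO-BH13-MEMO.md`; the assembly is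
`B9SmoothHolderClassTFromGradient`).  The tree holds the covariant telescope along def-Y's contour (dag-n06-w6 `B9Eq340TaxiTelescope`, dag-n06-c
`B9Eq340CovariantLipschitzY ∕ …HolderLipParSymY`), def-Y's bridge `gradY = c_f·cdS` (`OpsYNablaBridge`) and gradient model `DvcoKH` (`OpsYSectDCoords`), p22's
torus-distance bridge (`B6BlockDecayHprimeCovV1.torusSupNorm_rep_sub_rep`) and dag-n06-w6's LAYER B (`B9MultiscaleSmoothPartitionYNear`).  THIS FILE reads them at the
class `bHZT`'s pair functional `trDif b (taxiS U)`:
* §1 `rep_boxEquiv_symm`, ★ `cast_supDist_boxEquiv_symm` (`|chart⁻¹z − chart⁻¹z′|_∞ = |z − z′|_T`), `nKT_mul_pdist`, ★ `wEta_eq_inv_rpow_pdist` (the class's pair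
  weight IS `(η|z−z′|_T)^{−ε}`);
* §2 `taxiS_eq_parSY` (rfl), `DvcoKH_apply_repr` (rfl), ★ `norm_covD_assembleK_le` (a rung's lattice covariant difference of the re-assembled slice `Ψ_{ν,c′}` is
  `|c_f|⁻¹·(D_UΨ)(rung)`, hence `≤ |c_f|⁻¹(Σ‖b_c‖)·M` under a bound `M` on the gradient-model coordinates), ★★ `abs_trDif_taxiS_le`
  (`|repr_c(Ψ(z) − R(U(Γ_{z,z′}))Ψ(z′))| ≤ coordBound·(d+1)·|z−z′|_T·|c_f|⁻¹·(Σ‖b_c‖)·M` for unitary-like links);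
* §3 ★ `distT_blkOf_le_of_torusSupNorm_le` (ONE BLOCK FURTHER than LAYER B: `|v − z|_T ≤ L^{j(z)} ⇒ d_T(Δ(z), Δ(v)) ≤ 2(d+1)L² + 1`), `blkV1_mk_eq_blkOf_boxEquiv`,
  `lvl_sIK_eq_levY`, `torusSupNorm_boxEquiv_sub`, ★ `lvl_bI_rung_window`, ★★ `dist_bI_rung_le` (the index block of a rung bond `⟨w, μ⟩`, `|chart⁻¹z − w|_∞ ≤ L^{j(z)}`,
  `z ∈ Δ̃(y)`, is within `r_near + 2(d+1)L² + 2` of `y` and two levels of `j(y)`), ★ `len_rpow_le_of_lvl_window` (`(Lʲ″η)^x ≤ L^{n|x|}(Lʲη)^x`, every real `x`).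
HONEST SCOPE.  Finite-lattice bookkeeping over landed objects; nothing of [B9]∕[4] asserted; constants ours, not optimised; no pin, no certificate edit; COUNT-NEUTRAL;
N06 NOT discharged; nothing continuum, nothing about the mass gap.  Cell `pub-ymgap` (HUMAN RULING D-0062), Track A node N06 [B9], seat `pub-ymgap-dag-n06-l` (g24), 2026-08-29.
-/

noncomputable section

namespace Literature.MathematicalPhysics.QuantumFieldTheory.Balaban1983to89.B9SmoothHolderClassTGradientTools

open B4TorusKernel.MultiPeriod (torusSupNorm torusSupNorm_nonneg)
open B6GlobalChartV1 (PV blkV1 boxEquiv boxEquiv_apply toBox_apply val_boxEquiv_symm)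
open B6Geom246MultiLevelBox (blkOf)
open B6Geom246MultiLevelTorus (bondT geomT torusSupNorm_neg)
open B6Ineq2142KLevelV1 (β lvl)
open B6KLevelCensusIndexV1 (KIdx)
open B6Prop22KLevelTorusCensusEta (nKT one_le_nKT nKT_pos)
open B6LowerBound2153Torus (rep)
open B6BlockDecayHprimeCovV1 (torusSupNorm_rep_sub_rep)
open B9GeoNormsKLevelV1 (geo9K geo9K_len_kGeo)
open B9GeoLemma21KLevelV1 (geo9K_dist_triangle geo9K_len_pos geo9K_dist_eq)
open B9Thm34Ext (toB6)
open B9Thm39ReadingCoords (coordBound39 basisBound39 abs_repr_le)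
open B11SectG (BlockNorm HasMaj)
open B9SectDSup (weightNorm weightNorm_loc)
open B11SectGGlobal (Size)
open B11SectGGlobalSizes
open B11SectGSmoothCutT (Size.ofPairsT ofPairsT_sz_le)
open B9Thm312WholeClasses (cNormR cNormR_loc)
open B9Eq39Adjoint (R covD)
open B9BackgroundsKLevelV1 (shiftsV1)
open B9Eq340StepLasso (rungSites taxiSteps)
open B9Eq340TaxiTelescope (supDist_rungSites_taxiSteps_le)
open B9Eq340CovariantLipschitzY (norm_R_parSY_sub_le length_taxiSteps_le_mul_pdist pdist_pos_of_ne)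
open B9Eq340HolderLipParSymY (covD_comp_boxEquiv pdist_comm)
open B9CoReadingCoords (XBK blkBK assembleK norm_le_basisBound_mul)
open B9CoReadingCoordsS (XSK sIK blkSK)
open B9GradViaDivLettersTransported (taxiS)
open B9GradViaDivLettersAtPinsHolderPairs (sIK_chartY)
open B9MultiscaleSmoothPartitionY (scl scl_pos NearY levY_window levY_window_of_nearY levY_eq_blkOf)
open B9MultiscaleSmoothPartitionYNear (rNear rNear_nonneg distT_carrier_blkOf_le_of_nearY)
open B9SmoothHolderClassS (NearPair wEta wEta_nonneg Wscl Wscl_nonneg scl_div_nKT_pos_le_one one_le_Wscl)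
open B9SmoothHolderClassT (trDif trDif_apply bHZT bHZT_loc)
open B9SmoothHolderClassTClosure (abs_cf_eq_nKT len_eq_scl_div len_le_one len_rpow_neg_eq_Wscl hasMaj_ofBlocks_of_cNormR abs_apply_le_of_hasMaj_cNormR)
open Node00 (SiteY FBondY IBondY toKT levY CfgY parSY cdS)
open Node00.OpsYHolderFar (pdist pdist_nonneg)
open Node00.OpsYNablaBridge (chartY chartY_eq gradY_apply_eq_cdS)
open Node00.OpsYSectDCoords (DvcoKH)
open LatticeFieldCalculus (supDist)
open T4RelativeLadder (UnitaryLike)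

variable {d ℓ : ℕ} {hd : 1 ≤ d + 1} {hL : Odd (ℓ + 1) ∧ 1 < ℓ + 1} {b₀ b₁ : ℝ}
variable {𝔸 : Type} [NormedRing 𝔸] [NormedAlgebra ℂ 𝔸]
variable {κ : Type} [Fintype κ]
variable (i : KIdx d ℓ hd hL b₀ b₁)
/-! ## §1 The chart: the lattice sup-distance IS print's torus distance; the class's pair weight IS `(η|z − z′|_T)^{−ε}` -/

section Chart

omit [NormedRing 𝔸] [NormedAlgebra ℂ 𝔸] [Fintype κ] in
/-- the box representative of the charted site `chart⁻¹ z` is `z`. [cite: Balaban1984PropagatorsII, (2.1) p.224, dictionary] -/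
theorem rep_boxEquiv_symm (z : SiteY i) :
    rep (fun _ : Fin (d + 1) => (PV d ℓ i.m i.K hd hL).sitesPerDir 0) ((boxEquiv i.hN).symm z) = z.1 := by
  funext μ
  exact val_boxEquiv_symm i.hN z μ

omit [NormedRing 𝔸] [NormedAlgebra ℂ 𝔸] [Fintype κ] in
/-- ★ **THE LATTICE SUP-DISTANCE OF THE CHARTED SITES IS PRINT'S TORUS DISTANCE**: `|chart⁻¹ z − chart⁻¹ z′|_∞ = |z − z′|_T` (coordinatewise
`min{(a−b) mod N, (b−a) mod N} = dist(a − b, Nℤ)`). [cite: Balaban1985BackgroundPropagators, (3.40) p.397; Balaban1984PropagatorsII, (2.1) p.224, dictionary] -/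
theorem cast_supDist_boxEquiv_symm (z z' : SiteY i) :
    ((supDist ((boxEquiv i.hN).symm z) ((boxEquiv i.hN).symm z') : ℕ) : ℝ) = torusSupNorm (toKT i).NB (z.1 - z'.1) := by
  have h := torusSupNorm_rep_sub_rep (fun _ : Fin (d + 1) => (PV d ℓ i.m i.K hd hL).sitesPerDir 0) ((boxEquiv i.hN).symm z)
    ((boxEquiv i.hN).symm z')
  rw [rep_boxEquiv_symm, rep_boxEquiv_symm] at h
  have hM : (fun _ : Fin (d + 1) => (PV d ℓ i.m i.K hd hL).sitesPerDir 0) = (toKT i).NB := funext fun μ => (i.hN μ).symm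
  rw [hM] at h
  exact h.symm

omit [NormedRing 𝔸] [NormedAlgebra ℂ 𝔸] [Fintype κ] in
/-- `Lᵏ·(η|z − z′|_T) = |z − z′|_T`. [cite: Balaban1985BackgroundPropagators, (3.40) p.397, dictionary] -/
theorem nKT_mul_pdist (z z' : SiteY i) : (nKT (toKT i) : ℝ) * pdist i z z' = torusSupNorm (toKT i).NB (z.1 - z'.1) := by
  have hn : (0 : ℝ) < (nKT (toKT i) : ℝ) := by exact_mod_cast nKT_pos (toKT i)
  rw [pdist_comm, pdist, mul_div_cancel₀ _ hn.ne']

omit [NormedRing 𝔸] [NormedAlgebra ℂ 𝔸] [Fintype κ] in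
/-- ★ the class's η-scale pair weight is `(η|z − z′|_T)^{−ε} = (pdist z z′)^{−ε}`. [cite: Balaban1985BackgroundPropagators, (3.40) p.397, dictionary] -/
theorem wEta_eq_inv_rpow_pdist (ε : ℝ) (q q' : XSK κ i) : wEta i ε q q' = (pdist i q.1 q'.1 ^ ε)⁻¹ := by
  rw [wEta, pdist_comm, pdist]

end Chart

/-! ## §2 The covariant telescope read in coordinates: the transported pair difference from the gradient model `DvcoKH` -/

section Telescope

variable [CompleteSpace 𝔸] [FiniteDimensional ℝ 𝔸] (b : Module.Basis κ ℝ 𝔸) (B : B9.Backgrounds) (cfg : B.Cfg → CfgY 𝔸 i)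

omit [FiniteDimensional ℝ 𝔸] in
/-- `taxiS` IS def-Y's site transporter `parSY` at the read configuration. [cite: Balaban1985BackgroundPropagators, (3.40) p.397 («Γ_{x,x′}»), dictionary] -/
theorem taxiS_eq_parSY (U : B.Cfg) : taxiS i B cfg U = parSY i (cfg U) := rfl

omit [FiniteDimensional ℝ 𝔸] in
/-- the gradient model reads the coordinates of `D_U` of the re-assembled slice: `(DvcoKH U F)(x, ν, c, c′) = repr_c ((D_U Ψ_{ν,c′})(x))`, `Ψ_{ν,c′} := assembleK b ν c′ F`.
[cite: Balaban1985BackgroundPropagators, (3.3) p.390 + (3.124) p.420, dictionary] -/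
theorem DvcoKH_apply_repr (U : B.Cfg) (F : XSK κ i → ℝ) (x : FBondY i) (ν : Fin (d + 1)) (c c' : κ) :
    DvcoKH i b B cfg U F (x, ν, c, c') = b.repr (Node00.gradY i (cfg U) (assembleK b ν c' F) x) c := rfl

omit [FiniteDimensional ℝ 𝔸] in
/-- ★ **THE RUNG READING**: the lattice-unit covariant difference of the re-assembled slice `Ψ_{ν,c′} ∘ chart` at a rung `(w, μ)` is `|c_f|⁻¹·(D_UΨ)(⟨w, μ⟩)`
((3.3): `D_U = c_f·∇_U` at the charted source), hence `≤ |c_f|⁻¹·(Σ_c‖b_c‖)·M` whenever the gradient-model coordinates `|(DvcoKH U F)(⟨w,μ⟩, ν, c, c′)| ≤ M`.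
[cite: Balaban1985BackgroundPropagators, (3.3) pp.390–391, (3.39) p.397, bookkeeping] -/
theorem norm_covD_assembleK_le (U : B.Cfg) (F : XSK κ i → ℝ) (ν : Fin (d + 1)) (c' : κ) (w : Site (PV d ℓ i.m i.K hd hL) 0) (μ : Fin (d + 1))
    {M : ℝ} (hM : ∀ c, |DvcoKH i b B cfg U F (⟨w, μ⟩, ν, c, c')| ≤ M) :
    ‖covD (shiftsV1 (PV d ℓ i.m i.K hd hL)) (cfg U) μ (fun x => assembleK b ν c' F (boxEquiv i.hN x)) w‖ ≤ |i.cf|⁻¹ * (basisBound39 b * M) := by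
  rw [covD_comp_boxEquiv]
  have hg := gradY_apply_eq_cdS i (cfg U) (assembleK b ν c' F) ⟨w, μ⟩
  have hcf : ((i.cf : ℝ) : ℂ) ≠ 0 := by exact_mod_cast i.hcf
  have hcd : cdS i (cfg U) μ (assembleK b ν c' F) (boxEquiv i.hN w) = ((i.cf : ℝ) : ℂ)⁻¹ • Node00.gradY i (cfg U) (assembleK b ν c' F) ⟨w, μ⟩ := by
    rw [hg, smul_smul, inv_mul_cancel₀ hcf, one_smul]
    rfl
  rw [hcd, norm_smul, norm_inv, Complex.norm_real, Real.norm_eq_abs]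
  refine mul_le_mul_of_nonneg_left (norm_le_basisBound_mul b _ fun c => ?_) (inv_nonneg.2 (abs_nonneg _))
  rw [← DvcoKH_apply_repr]
  exact hM c

/-- ★★ **THE TRANSPORTED PAIR DIFFERENCE ALONG def-Y's TAXICAB TABLE, FROM THE GRADIENT MODEL**: for unitary-like bond variables, if the gradient-model
coordinates of `F` are `≤ M` at every rung bond of `Γ_{z,z′}` (slice `ν`, lift `c′`), then
`|trDif b (taxiS U) q q′ F| ≤ coordBound·(d+1)·|z − z′|_T·|c_f|⁻¹·(Σ‖b_c‖)·M` — print's mean-value step `|Ψ(z) − R(U(Γ_{z,z′}))Ψ(z′)| ≤ |Γ_{z,z′}|·sup_Γ|∇_UΨ|`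
read in the frame `b`. [cite: Balaban1985BackgroundPropagators, (3.40) p.397 + (3.3) p.391 + p.423 (the mean-value step)] -/
theorem abs_trDif_taxiS_le {U : B.Cfg} (hU : ∀ ν x, UnitaryLike (cfg U ν x)) (F : XSK κ i → ℝ) (q q' : XSK κ i) {M : ℝ} (hM0 : 0 ≤ M)
    (hM : ∀ r ∈ rungSites (taxiSteps (List.finRange (d + 1)) ((boxEquiv i.hN).symm q.1) ((boxEquiv i.hN).symm q'.1)) ((boxEquiv i.hN).symm q.1),
      ∀ c, |DvcoKH i b B cfg U F (⟨r.1, r.2.1⟩, q.2.1, c, q.2.2.2)| ≤ M) :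
    |trDif b (taxiS i B cfg U) q q' F| ≤
      coordBound39 b * ((((d : ℝ) + 1) * ((nKT (toKT i) : ℝ) * pdist i q.1 q'.1)) * (|i.cf|⁻¹ * (basisBound39 b * M))) := by
  rw [trDif_apply, taxiS_eq_parSY]
  refine (abs_repr_le b _ _).trans (mul_le_mul_of_nonneg_left ?_ (norm_nonneg _))
  rw [norm_sub_rev]
  have hG0 : 0 ≤ |i.cf|⁻¹ * (basisBound39 b * M) :=
    mul_nonneg (inv_nonneg.2 (abs_nonneg _)) (mul_nonneg (Finset.sum_nonneg fun _ _ => norm_nonneg _) hM0)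
  refine (norm_R_parSY_sub_le i hU (assembleK b q.2.1 q.2.2.2 F) q.1 q'.1 fun r hr =>
    norm_covD_assembleK_le i b B cfg U F q.2.1 q.2.2.2 r.1 r.2.1 (hM r hr)).trans ?_
  exact mul_le_mul_of_nonneg_right (length_taxiSteps_le_mul_pdist i q.1 q'.1) hG0

end Telescope

/-! ## §3 Geometry: the block of a rung bond of a near pair seen from `Δ̃(y)` -/

section Geometry

/-- ★ **ONE BLOCK FURTHER**: if `|v − z|_T ≤ L^{j(z)}` then `d_T(Δ(z), Δ(v)) ≤ 2(d+1)L² + 1` — the staircase walk `z ⇝ v` in the sup-ball of radius `L^{j(z)}` about `z`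
stays in the two-level window of [4] (2.2) (levels `≥ j(z) − 1`), so its weighted length is `≤ (d+1)·L`, and `d_T ≤ 2L·W + 1` (dag-n06-w6's LAYER B, anchored at `z` itself).
[cite: Balaban1984PropagatorsII, (2.46) p.231 + (2.2) p.224; Balaban1985BackgroundPropagators, (3.40) p.397 («|x − x′| ≦ 1»)] -/
theorem distT_blkOf_le_of_torusSupNorm_le {z v : SiteY i} (h : torusSupNorm (toKT i).NB (v.1 - z.1) ≤ (((ℓ + 1 : ℕ) : ℝ)) ^ levY i z) :
    (((bondT i.D).dist (blkOf i.D.toDomains z) (blkOf i.D.toDomains v) : ℕ) : ℝ) ≤ 2 * ((d : ℝ) + 1) * (((ℓ + 1 : ℕ) : ℝ)) ^ 2 + 1 := by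
  obtain ⟨p, hlen, hball⟩ := B6TorusGeodesicWalks.exists_ballWalk z v
  have hL1 : (1 : ℝ) ≤ ((ℓ + 1 : ℕ) : ℝ) := by exact_mod_cast Nat.succ_le_succ (Nat.zero_le ℓ)
  have hL0 : (0 : ℝ) < ((ℓ + 1 : ℕ) : ℝ) := by positivity
  have hj1 : 1 ≤ levY i z := (toKT i).D.one_le_lev z.1
  -- every site of the walk lies in the two-level window about `z`
  have hJ : ∀ u ∈ p.support, levY i z - 1 ≤ i.D.lev u.1 := by
    intro u hu
    have h6 : torusSupNorm (toKT i).NB (u.1 - z.1) ≤ 6 * (((ℓ + 1 : ℕ) : ℝ)) ^ levY i z :=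
      (hball u hu).trans (h.trans (by nlinarith [pow_pos hL0 (levY i z)]))
    have hw := (levY_window i h6).1
    show levY i z - 1 ≤ levY i u
    omega
  have hw : B6TorusSiteWalks.wtLen i.D p ≤ (p.length : ℝ) * ((((ℓ + 1) ^ (levY i z - 1) : ℕ) : ℝ))⁻¹ :=
    B6TorusGeodesicWalks.wtLen_le_length_mul i.D p hJ
  have hpow : (((ℓ + 1 : ℕ) : ℝ)) ^ levY i z = ((((ℓ + 1) ^ (levY i z - 1) : ℕ) : ℝ)) * ((ℓ + 1 : ℕ) : ℝ) := by
    rw [Nat.cast_pow]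
    conv_lhs => rw [← Nat.sub_add_cancel hj1, pow_succ]
  have hLj0 : (0 : ℝ) < ((((ℓ + 1) ^ (levY i z - 1) : ℕ) : ℝ)) := by positivity
  have hlen' : (p.length : ℝ) ≤ ((d : ℝ) + 1) * (((((ℓ + 1) ^ (levY i z - 1) : ℕ) : ℝ)) * ((ℓ + 1 : ℕ) : ℝ)) := by
    rw [← hpow]; exact hlen.trans (mul_le_mul_of_nonneg_left h (by positivity))
  have hw' : B6TorusSiteWalks.wtLen i.D p ≤ ((d : ℝ) + 1) * ((ℓ + 1 : ℕ) : ℝ) := by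
    refine hw.trans ?_
    rw [← div_eq_mul_inv, div_le_iff₀ hLj0]
    nlinarith [hlen']
  have hR : 1 ≤ i.R := le_trans (by nlinarith [Nat.one_le_pow 2 (ℓ + 1) (Nat.succ_pos ℓ)]) i.hR2
  have hMh : 1 ≤ i.Mh := le_trans (by norm_num) i.hM8
  have hP : ∀ μ, 1 ≤ i.P' μ := fun μ => le_trans (by norm_num) (i.hP5 μ)
  have hℓ : 1 ≤ ℓ := le_trans (by norm_num) i.hℓ
  refine (B6AgmonExponentMultiLevelTorus.distT_blkOf_le_of_walk i.D hR hMh hP hℓ p).trans ?_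
  nlinarith [hw', hL0, B6TorusSiteWalks.wtLen_nonneg i.D p]

/-- the block of a fine bond is the block of its charted source: `blkV1 ⟨w, μ⟩ = Δ(chart w)`. [cite: Balaban1984PropagatorsII, (2.45) p.231, dictionary] -/
theorem blkV1_mk_eq_blkOf_boxEquiv (w : Site (PV d ℓ i.m i.K hd hL) 0) (μ : Fin (d + 1)) :
    blkV1 i.hN i.D (⟨w, μ⟩ : FBondY i) = blkOf i.D.toDomains (boxEquiv i.hN w) := rfl

/-- the index block of a SITE (`sIK bI z = bI ⟨chart⁻¹ z, e₀⟩`) sits at the level of the site, for a level-faithful block map (the certificate's pin `hlev`).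
[cite: Balaban1984PropagatorsII, (2.45) p.231, bookkeeping] -/
theorem lvl_sIK_eq_levY {bI : FBondY i → IBondY i} (hlev : ∀ f : FBondY i, lvl i.hN i.D i.hk (bI f) = (blkV1 i.hN i.D f).1.1) (z : SiteY i) :
    lvl i.hN i.D i.hk (sIK i bI z) = levY i z := by
  rw [sIK, hlev, blkV1_mk_eq_blkOf_boxEquiv, Equiv.apply_symm_apply, levY_eq_blkOf]

/-- the torus distance of a charted lattice site from `z` is the lattice sup-distance from `chart⁻¹ z`. [cite: Balaban1984PropagatorsII, (2.1) p.224, dictionary] -/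
theorem torusSupNorm_boxEquiv_sub (z : SiteY i) (w : Site (PV d ℓ i.m i.K hd hL) 0) :
    torusSupNorm (toKT i).NB ((boxEquiv i.hN w).1 - z.1) = ((supDist ((boxEquiv i.hN).symm z) w : ℕ) : ℝ) := by
  rw [← torusSupNorm_neg (fun ν => B6MultiLevelTorusOperator.one_le_N0 (toKT i).hMh (toKT i).hP ν), neg_sub,
    ← cast_supDist_boxEquiv_symm i z (boxEquiv i.hN w), Equiv.symm_apply_apply]

/-- ★ **THE LEVEL WINDOW OF A RUNG BOND**: for `z ∈ Δ̃(y)` and `|chart⁻¹ z − w|_∞ ≤ L^{j(z)}`, the index block of `⟨w, μ⟩` has level within 2 of `j(y)` (two applications of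
[4] (2.2): `j(chart w) ∈ [j(z) − 1, j(z) + 1]`, `j(z) ∈ [j(y) − 1, j(y) + 1]`). [cite: Balaban1984PropagatorsII, (2.2) p.224 + (2.45) p.231; Balaban1985BackgroundPropagators, (3.43) p.398 («Δ̃(y)»)] -/
theorem lvl_bI_rung_window {bI : FBondY i → IBondY i} (hlev : ∀ f : FBondY i, lvl i.hN i.D i.hk (bI f) = (blkV1 i.hN i.D f).1.1)
    {y : IBondY i} {z : SiteY i} (hyz : NearY i y z) {w : Site (PV d ℓ i.m i.K hd hL) 0}
    (hw : ((supDist ((boxEquiv i.hN).symm z) w : ℕ) : ℝ) ≤ (((ℓ + 1 : ℕ) : ℝ)) ^ levY i z) (μ : Fin (d + 1)) :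
    lvl i.hN i.D i.hk (bI ⟨w, μ⟩) ≤ lvl i.hN i.D i.hk y + 2 ∧ lvl i.hN i.D i.hk y ≤ lvl i.hN i.D i.hk (bI ⟨w, μ⟩) + 2 := by
  have hL0 : (0 : ℝ) < ((ℓ + 1 : ℕ) : ℝ) := by positivity
  have hT : torusSupNorm (toKT i).NB ((boxEquiv i.hN w).1 - z.1) ≤ (((ℓ + 1 : ℕ) : ℝ)) ^ levY i z := by rw [torusSupNorm_boxEquiv_sub]; exact hw
  have hwin := levY_window i (hT.trans (by nlinarith [pow_pos hL0 (levY i z)]))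
  have hwin' := levY_window_of_nearY i hyz
  have hlw : lvl i.hN i.D i.hk (bI ⟨w, μ⟩) = levY i (boxEquiv i.hN w) := by rw [hlev, blkV1_mk_eq_blkOf_boxEquiv, levY_eq_blkOf]
  constructor <;> omega

/-- ★★ **THE RUNG BOND BLOCK SEEN FROM `Δ̃(y)`**: for `z ∈ Δ̃(y)` and a lattice site `w` with `|chart⁻¹ z − w|_∞ ≤ L^{j(z)}` (every rung of the taxicab contour of a near
pair based at `z`), the index block of the bond `⟨w, μ⟩` under a 1-faithful block map `bI` is within `r_near + 2(d+1)L² + 2` of `y` in def-Y's reading distance.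
[cite: Balaban1984PropagatorsII, (2.45)–(2.46) p.231 + (2.2) p.224; Balaban1985BackgroundPropagators, (3.40) p.397 + (3.43) p.398 («Δ̃(y)»)] -/
theorem dist_bI_rung_le {bI : FBondY i → IBondY i} (hβ1 : ∀ f : FBondY i, (geomT i.D).dist (β i.hN i.D i.hk (bI f)) (blkV1 i.hN i.D f) ≤ 1)
    {y : IBondY i} {z : SiteY i} (hyz : NearY i y z) {w : Site (PV d ℓ i.m i.K hd hL) 0}
    (hw : ((supDist ((boxEquiv i.hN).symm z) w : ℕ) : ℝ) ≤ (((ℓ + 1 : ℕ) : ℝ)) ^ levY i z) (μ : Fin (d + 1)) :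
    (geo9K i).dist y (bI ⟨w, μ⟩) ≤ rNear d ℓ + (2 * ((d : ℝ) + 1) * (((ℓ + 1 : ℕ) : ℝ)) ^ 2 + 2) := by
  have hMh : 1 ≤ i.Mh := le_trans (by norm_num) i.hM8
  have hP : ∀ μ, 1 ≤ i.P' μ := fun μ => le_trans (by norm_num) (i.hP5 μ)
  have hT : torusSupNorm (toKT i).NB ((boxEquiv i.hN w).1 - z.1) ≤ (((ℓ + 1 : ℕ) : ℝ)) ^ levY i z := by rw [torusSupNorm_boxEquiv_sub]; exact hw
  have h1 := distT_carrier_blkOf_le_of_nearY i hyz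
  have h2 := distT_blkOf_le_of_torusSupNorm_le i hT
  have h3 : (geomT i.D).dist (blkOf i.D.toDomains (boxEquiv i.hN w)) (β i.hN i.D i.hk (bI ⟨w, μ⟩)) ≤ 1 := by
    rw [B6HolderPairInputsV1.geomT_dist_comm, ← blkV1_mk_eq_blkOf_boxEquiv]; exact hβ1 ⟨w, μ⟩
  rw [geo9K_dist_eq]
  calc (((bondT i.D).dist (β i.hN i.D i.hk y) (β i.hN i.D i.hk (bI ⟨w, μ⟩)) : ℕ) : ℝ)
      = (geomT i.D).dist (β i.hN i.D i.hk y) (β i.hN i.D i.hk (bI ⟨w, μ⟩)) := rfl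
    _ ≤ (geomT i.D).dist (β i.hN i.D i.hk y) (blkOf i.D.toDomains z) + (geomT i.D).dist (blkOf i.D.toDomains z) (β i.hN i.D i.hk (bI ⟨w, μ⟩)) :=
        B6HolderPairInputsV1.geomT_dist_triangle hMh hP _ _ _
    _ ≤ (geomT i.D).dist (β i.hN i.D i.hk y) (blkOf i.D.toDomains z) + ((geomT i.D).dist (blkOf i.D.toDomains z) (blkOf i.D.toDomains (boxEquiv i.hN w)) +
          (geomT i.D).dist (blkOf i.D.toDomains (boxEquiv i.hN w)) (β i.hN i.D i.hk (bI ⟨w, μ⟩))) :=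
        add_le_add le_rfl (B6HolderPairInputsV1.geomT_dist_triangle hMh hP _ _ _)
    _ ≤ rNear d ℓ + ((2 * ((d : ℝ) + 1) * (((ℓ + 1 : ℕ) : ℝ)) ^ 2 + 1) + 1) := add_le_add h1 (add_le_add h2 h3)
    _ = _ := by ring

/-- ★ **THE TWO-SIDED LEVEL WINDOW IN LENGTHS**: `|j(y″) − j(y)| ≤ n ⇒ (Lʲ″η)^x ≤ L^{n|x|}·(Lʲη)^x` for every real power `x` (at print's units).
[cite: Balaban1984PropagatorsII, (2.1)–(2.2) p.224, bookkeeping] -/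
theorem len_rpow_le_of_lvl_window (hcf : |i.cf| = (nKT (toKT i) : ℝ)) {y y'' : IBondY i} {n : ℕ}
    (h1 : lvl i.hN i.D i.hk y'' ≤ lvl i.hN i.D i.hk y + n) (h2 : lvl i.hN i.D i.hk y ≤ lvl i.hN i.D i.hk y'' + n) (x : ℝ) :
    (geo9K i).len y'' ^ x ≤ (((ℓ + 1 : ℕ) : ℝ)) ^ ((n : ℝ) * |x|) * (geo9K i).len y ^ x := by
  have hL1 : (1 : ℝ) ≤ ((ℓ + 1 : ℕ) : ℝ) := by exact_mod_cast Nat.succ_le_succ (Nat.zero_le ℓ)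
  have hL0 : (0 : ℝ) < ((ℓ + 1 : ℕ) : ℝ) := by positivity
  have hn : (0 : ℝ) < (nKT (toKT i) : ℝ) := by exact_mod_cast nKT_pos (toKT i)
  set m : ℤ := ((lvl i.hN i.D i.hk y'' : ℕ) : ℤ) - ((lvl i.hN i.D i.hk y : ℕ) : ℤ) with hm
  have hmn : |(m : ℝ)| ≤ (n : ℝ) := by
    rw [hm]; push_cast
    exact abs_le.2 ⟨by exact_mod_cast (by omega : -(n : ℤ) ≤ (lvl i.hN i.D i.hk y'' : ℤ) - lvl i.hN i.D i.hk y),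
      by exact_mod_cast (by omega : ((lvl i.hN i.D i.hk y'' : ℤ) - lvl i.hN i.D i.hk y) ≤ n)⟩
  -- `Lʲ″η = Lʲη · L^m`
  have hratio : (geo9K i).len y'' = (geo9K i).len y * (((ℓ + 1 : ℕ) : ℝ)) ^ (m : ℝ) := by
    rw [len_eq_scl_div i hcf, len_eq_scl_div i hcf, scl, scl, div_mul_eq_mul_div, Real.rpow_intCast, ← zpow_natCast, ← zpow_natCast,
      ← zpow_add₀ hL0.ne', hm]
    congr 2
    ring
  rw [hratio, Real.mul_rpow (geo9K_len_pos i y).le (Real.rpow_nonneg hL0.le _), mul_comm, ← Real.rpow_mul hL0.le]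
  refine mul_le_mul_of_nonneg_right (Real.rpow_le_rpow_of_exponent_le hL1 ?_) (Real.rpow_nonneg (geo9K_len_pos i y).le _)
  calc (m : ℝ) * x ≤ |(m : ℝ) * x| := le_abs_self _
    _ = |(m : ℝ)| * |x| := abs_mul _ _
    _ ≤ (n : ℝ) * |x| := mul_le_mul_of_nonneg_right hmn (abs_nonneg _)

end Geometry

end Literature.MathematicalPhysics.QuantumFieldTheory.Balaban1983to89.B9SmoothHolderClassTGradientTools

end
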